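import Summits.NavierStokesRegularity.TurbBounds.ShearSpecForms
import HarnessLib

/-!
# Closed-form entries of the SPEC §2.4–2.8 tables of `ShearSpecPieces` (`Q1`, `K⁽ᵖ⁾`, `E⁽ᵖ⁾`, `H1`, `G0`, `H0`, `R`, projection, pieces)

Cell `turb-bounds` (pub-turb), shear lane, pub-turb-shear gen 6 (2026-08-22); v2 lane. Continuation of `ShearSpecForms` (generic `get2` semantics of the list
constructors): here the fw16 tables themselves, entrywise, as `Finset` sums — `get2_q1Tab` (SPEC 2.4), `get2_kTab` / `get2_eTab` (2.5, `E = D0cᵀ K D1`),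
`getD_h1Diag` / `get2_g0Tab` / `get2_h0Tab` / `get2_rTab` (2.6–2.7), `get2_projTab` / `projEntry_eq` and the definitional `q0Piece_eq` / `qphiPiece_eq` / `qtPiece_eq` (2.8).
This is what the Legendre–Galerkin bridge consumes: together with `Certs/<Row>/SpecPieces*` (literal pieces = these tables, kernel) the certificate matrices
acquire closed-form entries generic in `(N, P)`. PURE LIST/FINSET ALGEBRA over `ℚ`.
HONEST FRAMING: rigorous bounds for the stated PDE and boundary conditions; no claim about physical turbulence beyond the bound.
-/

set_option linter.style.longLine false

namespace Summit.NavierStokesRegularity.TurbBounds.ShearSpecPieces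

open List Finset

/-! ### §2.4: `Q1` entrywise -/

/-- **`Q1` entrywise** (SPEC 2.4): `Q1[j][k] = [j = k < L2]·A·w_j + 8·Σ_{n<N+2} w_n D1[n][j] D1[n][k] + C·Σ_{n<N+1} w_n D0c[n][j] D0c[n][k]`. -/
theorem get2_q1Tab (N P : ℕ) (A C : ℚ) (j k : ℕ) :
    get2 (q1Tab N P A C) j k
      = (if j < N + P + 4 ∧ j = k then A * norm2 j else 0)
        + ∑ n ∈ range (N + 2), 8 * norm2 n * get2 (d1Rows N P) n j * get2 (d1Rows N P) n k
        + ∑ n ∈ range (N + 1), C * norm2 n * get2 (d0cRows N P) n j * get2 (d0cRows N P) n k := by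
  unfold q1Tab
  simp only
  -- shapes
  have hdiag : Shaped (N + P + 4) (N + P + 4)
      ((List.range (N + P + 4)).map fun j => (List.range (N + P + 4)).map fun k => if j = k then A * norm2 j else 0) := by
    refine ⟨by simp, fun r hr => ?_⟩
    rw [List.getD_eq_getElem _ _ (by simpa using hr)]; simp
  have h1z : (List.range (N + 2)).zip ((d1Rows N P).take (N + 2))
      = (List.range (N + 2)).map fun i => (i, (d1Rows N P).getD i []) := by
    rw [zip_range_eq_map_getD _ [] (by simp [length_d1Rows]; omega)]
    refine List.map_congr_left fun i hi => ?_
    have hi' : i < N + 2 := by simpa using hi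
    simp only [List.getD_eq_getElem?_getD, List.getElem?_take, if_pos hi']
  have h0z : (List.range (N + 1)).zip ((d0cRows N P).take (N + 1))
      = (List.range (N + 1)).map fun i => (i, (d0cRows N P).getD i []) := by
    rw [zip_range_eq_map_getD _ [] (by simp [d0cRows]; omega)]
    refine List.map_congr_left fun i hi => ?_
    have hi' : i < N + 1 := by simpa using hi
    simp only [List.getD_eq_getElem?_getD, List.getElem?_take, if_pos hi']
  have hL1 : ∀ nr ∈ (List.range (N + 2)).zip ((d1Rows N P).take (N + 2)), nr.2.length = N + P + 4 := by
    intro nr h; rw [h1z] at h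
    obtain ⟨i, hi, rfl⟩ := List.mem_map.mp h
    exact length_getD_d1Rows N P i (by simp at hi; omega)
  have hL0 : ∀ nr ∈ (List.range (N + 1)).zip ((d0cRows N P).take (N + 1)), nr.2.length = N + P + 4 := by
    intro nr h; rw [h0z] at h
    obtain ⟨i, hi, rfl⟩ := List.mem_map.mp h
    have hi' : i < N + 1 := by simpa using hi
    unfold d0cRows
    rw [List.getD_eq_getElem _ _ (by simp; omega)]
    simp [length_d0cRow]
  have hg8 := shaped_foldl_gramAdd (fun nr => 8 * norm2 nr.1) _ _ hL1 hdiag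
  rw [get2_foldl_gramAdd (fun nr => C * norm2 nr.1) _ _ hL0 hg8, get2_foldl_gramAdd (fun nr => 8 * norm2 nr.1) _ _ hL1 hdiag,
    h1z, h0z, List.map_map, List.map_map, sum_map_range, sum_map_range]
  -- the diagonal seed
  have hd : get2 ((List.range (N + P + 4)).map fun j => (List.range (N + P + 4)).map fun k => if j = k then A * norm2 j else 0) j k
      = if j < N + P + 4 ∧ j = k then A * norm2 j else 0 := by
    rw [get2_eq, getD_map_range]
    by_cases hj : j < N + P + 4
    · rw [if_pos hj, getD_map_range]
      by_cases hjk : j = k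
      · subst hjk; simp [hj]
      · simp [hjk]
    · rw [if_neg hj, if_neg (fun h => hj h.1)]; rfl
  rw [hd]
  simp only [Function.comp, get2_eq]

/-! ### §2.5: `K⁽ᵖ⁾`, `E⁽ᵖ⁾` entrywise -/

/-- **`K⁽ᵖ⁾` entrywise** (SPEC 2.5). -/
theorem get2_kTab (N P p n m' : ℕ) :
    get2 (kTab N P p) n m' = if n < N + P + 2 ∧ m' < N + P + 3 then
      (if (m' ≤ N + 1 ∧ n ≤ N + P + 1) ∨ (N + 2 ≤ m' ∧ m' ≤ N + P ∧ n ≤ N) then triple m' n p else 0) else 0 := by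
  unfold kTab get2
  rw [getD_map_range]
  by_cases hn : n < N + P + 2
  · rw [if_pos hn, getD_map_range]
    by_cases hm : m' < N + P + 3
    · rw [if_pos hm, if_pos (show n < N + P + 2 ∧ m' < N + P + 3 from ⟨hn, hm⟩)]
    · rw [if_neg hm, if_neg (show ¬(n < N + P + 2 ∧ m' < N + P + 3) from fun h => hm h.2)]
  · rw [if_neg hn, if_neg (show ¬(n < N + P + 2 ∧ m' < N + P + 3) from fun h => hn h.1)]; rfl

/-- Shape of `K⁽ᵖ⁾`. -/
theorem length_kTab (N P p : ℕ) : (kTab N P p).length = N + P + 2 := by simp [kTab]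

/-- Rows of `K⁽ᵖ⁾` have length `N+P+3`. -/
theorem length_getD_kTab (N P p n : ℕ) (hn : n < N + P + 2) : ((kTab N P p).getD n []).length = N + P + 3 := by
  unfold kTab; rw [List.getD_eq_getElem _ _ (by simpa using hn)]; simp

/-- **An outer-product fold entrywise**: `(L.foldl (fun G xr => outerAdd xr.1 xr.2 G) G₀)[j][k] = G₀[j][k] + Σ_{xr ∈ L} (xr.1)_j·(xr.2)_k`. -/
theorem get2_foldl_outerAdd {n c : ℕ} :
    ∀ (L : List (List ℚ × List ℚ)) (G₀ : List (List ℚ)), (∀ xr ∈ L, xr.1.length = n ∧ xr.2.length = c) → Shaped n c G₀ → ∀ j k,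
      get2 (L.foldl (fun G xr => outerAdd xr.1 xr.2 G) G₀) j k = get2 G₀ j k + (L.map fun xr => xr.1.getD j 0 * xr.2.getD k 0).sum
  | [], G₀, _, _, j, k => by simp
  | xr :: L, G₀, hL, hG, j, k => by
      have h := hL xr List.mem_cons_self
      rw [List.foldl_cons, get2_foldl_outerAdd L _ (fun x hx => hL x (List.mem_cons_of_mem _ hx)) (shaped_outerAdd _ _ _ h.1 h.2 hG),
        get2_outerAdd _ _ _ h.1 h.2 hG]
      simp only [List.map_cons, List.sum_cons]
      ring

/-- `getD` of a `map` inside the range, with independent defaults. -/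
theorem getD_map_of_lt {α β : Type*} (f : α → β) (l : List α) (n : ℕ) (d : β) (d' : α) (h : n < l.length) :
    (l.map f).getD n d = (f (l.getD n d') : β) := by
  rw [List.getD_eq_getElem _ _ (by simpa using h), List.getElem_map, List.getD_eq_getElem _ _ h]

/-- The row operation of `eTab`: `krow ↦ Σ_{m'} krow[m'] • D1[m']` as a filtered `axpy` fold. -/
def kd1Row (N P : ℕ) (krow : List ℚ) : List ℚ :=
  ((krow.zip (d1Rows N P)).filter fun cv => cv.1 ≠ 0).foldl (fun acc cv => axpy cv.1 cv.2 acc) (zeroVec (N + P + 4))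

/-- `eTab` restated with `kd1Row` (definitional). -/
theorem eTab_eq (N P p : ℕ) :
    eTab N P p = ((d0cRows N P).zip ((kTab N P p).map (kd1Row N P))).foldl (fun G xr => outerAdd xr.1 xr.2 G)
      (zeroMat (N + P + 4) (N + P + 4)) := rfl

/-- Length of a `kd1Row` (for a row of `K⁽ᵖ⁾`). -/
theorem length_kd1Row (N P : ℕ) (krow : List ℚ) (hk : krow.length = N + P + 3) : (kd1Row N P krow).length = N + P + 4 := by
  unfold kd1Row
  refine length_foldl_axpy_filter (fun cv => cv.1) _ _ (fun cv hcv => ?_) (by simp [zeroVec])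
  rw [zip_eq_map_getD krow (d1Rows N P) 0 [] hk (length_d1Rows N P)] at hcv
  obtain ⟨i, hi, rfl⟩ := List.mem_map.mp hcv
  exact length_getD_d1Rows N P i (by simpa using hi)

/-- **`kd1Row` entrywise**: `(Σ_{m'} krow[m'] • D1[m'])_k = Σ_{m'<N+P+3} krow[m']·D1[m'][k]`. -/
theorem getD_kd1Row (N P : ℕ) (krow : List ℚ) (hk : krow.length = N + P + 3) (k : ℕ) :
    (kd1Row N P krow).getD k 0 = ∑ m' ∈ range (N + P + 3), krow.getD m' 0 * get2 (d1Rows N P) m' k := by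
  unfold kd1Row
  have hz := zip_eq_map_getD krow (d1Rows N P) 0 [] hk (length_d1Rows N P)
  have hL : ∀ cv ∈ krow.zip (d1Rows N P), cv.2.length = N + P + 4 := by
    intro cv hcv; rw [hz] at hcv
    obtain ⟨i, hi, rfl⟩ := List.mem_map.mp hcv
    exact length_getD_d1Rows N P i (by simpa using hi)
  rw [getD_foldl_axpy_filter (fun cv => cv.1) _ _ hL (by simp [zeroVec]), getD_zeroVec, zero_add, hz, List.map_map, sum_map_range]
  rfl

/-- **`E⁽ᵖ⁾` entrywise** (SPEC 2.5): `E⁽ᵖ⁾[j][k] = Σ_{n<N+P+2} D0c[n][j]·Σ_{m'<N+P+3} K⁽ᵖ⁾[n][m']·D1[m'][k]` (`= (D0cᵀ K⁽ᵖ⁾ D1)[j][k]`). -/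
theorem get2_eTab (N P p j k : ℕ) :
    get2 (eTab N P p) j k
      = ∑ n ∈ range (N + P + 2), get2 (d0cRows N P) n j * ∑ m' ∈ range (N + P + 3), get2 (kTab N P p) n m' * get2 (d1Rows N P) m' k := by
  rw [eTab_eq]
  have hlen_kd1 : ((kTab N P p).map (kd1Row N P)).length = N + P + 2 := by simp [length_kTab]
  have hlen_d0 : (d0cRows N P).length = N + P + 2 := by simp [d0cRows]
  have hrowK : ∀ n < N + P + 2, ((kTab N P p).getD n []).length = N + P + 3 := fun n hn => length_getD_kTab N P p n hn
  have hkd1n : ∀ n < N + P + 2, ((kTab N P p).map (kd1Row N P)).getD n [] = kd1Row N P ((kTab N P p).getD n []) :=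
    fun n hn => getD_map_of_lt _ _ _ _ [] (by rw [length_kTab]; exact hn)
  have hz := zip_eq_map_getD (d0cRows N P) ((kTab N P p).map (kd1Row N P)) [] [] hlen_d0 hlen_kd1
  have hL : ∀ xr ∈ (d0cRows N P).zip ((kTab N P p).map (kd1Row N P)), xr.1.length = N + P + 4 ∧ xr.2.length = N + P + 4 := by
    intro xr hxr; rw [hz] at hxr
    obtain ⟨i, hi, rfl⟩ := List.mem_map.mp hxr
    have hi' : i < N + P + 2 := by simpa using hi
    refine ⟨?_, ?_⟩
    · unfold d0cRows; rw [List.getD_eq_getElem _ _ (by simp; omega)]; simp [length_d0cRow]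
    · simp only; rw [hkd1n i hi']; exact length_kd1Row N P _ (hrowK i hi')
  rw [get2_foldl_outerAdd _ _ hL (shaped_zeroMat _ _), get2_zeroMat, zero_add, hz, List.map_map, sum_map_range]
  refine Finset.sum_congr rfl fun n hn => ?_
  have hn' : n < N + P + 2 := by simpa using hn
  simp only [Function.comp]
  rw [hkd1n n hn', getD_kd1Row N P _ (hrowK n hn')]
  rfl

/-! ### §2.6–2.7: `H1`, `G0`, `H0`, `R` entrywise -/

/-- Length of `h1Diag`. -/
theorem length_h1Diag (N P : ℕ) : (h1Diag N P).length = N + P + 4 := by simp [h1Diag]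

/-- **`H1` diagonal entrywise** (SPEC 2.6): for `j < L2`, `φ_j·[N+1 ≤ j ≤ N+P+3] + χ_j·[N+3 ≤ j ≤ N+P+3]`; `0` beyond. -/
theorem getD_h1Diag (N P j : ℕ) :
    (h1Diag N P).getD j 0 = if j < N + P + 4 then
      ((if N + 1 ≤ j ∧ j ≤ N + P + 3 then 4 / ((2 * (j : ℚ) + 1) ^ 2 * (2 * (j : ℚ) + 3)) else 0)
        + (if N + 3 ≤ j ∧ j ≤ N + P + 3 then 4 / ((2 * (j : ℚ) - 1) * (2 * (j : ℚ) + 1) ^ 2) else 0)) else 0 := by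
  unfold h1Diag; exact getD_map_range _ _ _ _

/-- **`G0` entrywise** (SPEC 2.6, ours): `G0[j][k] = φ_N·D1[N][j]D1[N][k] + 4/((2N+3)²(2N+5))·D1[N+1][j]D1[N+1][k]`. -/
theorem get2_g0Tab (N P j k : ℕ) :
    get2 (g0Tab N P) j k
      = 4 / ((2 * (N : ℚ) + 1) ^ 2 * (2 * (N : ℚ) + 3)) * get2 (d1Rows N P) N j * get2 (d1Rows N P) N k
        + 4 / ((2 * (N : ℚ) + 3) ^ 2 * (2 * (N : ℚ) + 5)) * get2 (d1Rows N P) (N + 1) j * get2 (d1Rows N P) (N + 1) k := by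
  unfold g0Tab
  simp only
  have h0 : Shaped (N + P + 4) (N + P + 4) (zeroMat (N + P + 4) (N + P + 4)) := shaped_zeroMat _ _
  have hN := length_getD_d1Rows N P N (by omega)
  have hN1 := length_getD_d1Rows N P (N + 1) (by omega)
  have h1 := shaped_gramAdd (4 / ((2 * (N : ℚ) + 1) ^ 2 * (2 * (N : ℚ) + 3))) _ _ hN h0
  rw [get2_gramAdd _ _ _ hN1 h1, get2_gramAdd _ _ _ hN h0, get2_zeroMat]
  simp only [get2_eq]
  ring

/-- Shape of `G0`. -/
theorem shaped_g0Tab (N P : ℕ) : Shaped (N + P + 4) (N + P + 4) (g0Tab N P) := by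
  unfold g0Tab
  exact shaped_gramAdd _ _ _ (length_getD_d1Rows N P (N + 1) (by omega))
    (shaped_gramAdd _ _ _ (length_getD_d1Rows N P N (by omega)) (shaped_zeroMat _ _))

/-- Shape of `diagMat`. -/
theorem shaped_diagMat (v : List ℚ) : Shaped v.length v.length (diagMat v) := by
  refine ⟨by simp [diagMat], fun r hr => ?_⟩
  unfold diagMat
  rw [List.getD_eq_getElem _ _ (by simpa using hr)]; simp

/-- `matScale` preserves the shape. -/
theorem shaped_matScale (a : ℚ) {n c : ℕ} {G : List (List ℚ)} (hG : Shaped n c G) : Shaped n c (matScale a G) := by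
  refine ⟨by simp [matScale, hG.1], fun r hr => ?_⟩
  unfold matScale
  rw [List.getD_eq_getElem _ _ (by simp [hG.1]; exact hr)]
  simp only [List.getElem_map, List.length_map]
  have := hG.2 r hr
  rwa [List.getD_eq_getElem _ _ (by rw [hG.1]; exact hr)] at this

/-- `matAdd` preserves the shape. -/
theorem shaped_matAdd {n c : ℕ} {G H : List (List ℚ)} (hG : Shaped n c G) (hH : Shaped n c H) : Shaped n c (matAdd G H) := by
  refine ⟨by simp [matAdd, hG.1, hH.1], fun r hr => ?_⟩
  unfold matAdd
  rw [getD_zipWith' _ [] [] [] _ _ _ (hG.1 ▸ hr) (hH.1 ▸ hr), List.length_zipWith, hG.2 r hr, hH.2 r hr, min_self]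

/-- **`H0` entrywise** (SPEC 2.6, ours): `H0 = G0 + μ·H1`. -/
theorem get2_h0Tab (N P j k : ℕ) :
    get2 (h0Tab N P) j k = get2 (g0Tab N P) j k + mu N * (if j = k then (h1Diag N P).getD j 0 else 0) := by
  unfold h0Tab
  have hd := shaped_diagMat (h1Diag N P)
  rw [length_h1Diag] at hd
  rw [get2_matAdd _ _ (shaped_g0Tab N P) (shaped_matScale _ hd), get2_matScale, get2_diagMat]

/-- Shape of `H0`. -/
theorem shaped_h0Tab (N P : ℕ) : Shaped (N + P + 4) (N + P + 4) (h0Tab N P) := by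
  unfold h0Tab
  have hd := shaped_diagMat (h1Diag N P)
  rw [length_h1Diag] at hd
  exact shaped_matAdd (shaped_g0Tab N P) (shaped_matScale _ hd)

/-- **`R` entrywise** (SPEC 2.7): `R = D·[(δ/2)·H0 + H1/(2δ)]`. -/
theorem get2_rTab (N P : ℕ) (D : ℚ) (j k : ℕ) :
    get2 (rTab N P D) j k
      = D * (delta N / 2 * get2 (h0Tab N P) j k + 1 / (2 * delta N) * (if j = k then (h1Diag N P).getD j 0 else 0)) := by
  unfold rTab
  have hd := shaped_diagMat (h1Diag N P)
  rw [length_h1Diag] at hd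
  rw [get2_matScale, get2_matAdd _ _ (shaped_matScale _ (shaped_h0Tab N P)) (shaped_matScale _ hd), get2_matScale, get2_matScale,
    get2_diagMat]

/-! ### §2.8: the projection -/

/-- **`projTab` entrywise**: inside `dim = 2(L2−1)` it is `projEntry`; `0` beyond. -/
theorem get2_projTab (Mf : ℕ → ℕ → ℚ) (L2 i j : ℕ) :
    get2 (projTab Mf L2) i j = if i < 2 * (L2 - 1) ∧ j < 2 * (L2 - 1) then projEntry Mf L2 i j else 0 := by
  unfold projTab get2
  rw [getD_map_range]
  by_cases hi : i < 2 * (L2 - 1)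
  · rw [if_pos hi, getD_map_range]
    by_cases hj : j < 2 * (L2 - 1)
    · rw [if_pos hj, if_pos ⟨hi, hj⟩]
    · rw [if_neg hj, if_neg (fun h => hj h.2)]
  · rw [if_neg hi, if_neg (fun h => hi h.1)]; rfl

/-- **`projEntry` written out**: `Σ_{(r,c) ∈ col i} Σ_{(s,d) ∈ col j} c·d·Mf r s` with `col i = [(off+1, 1), (off, 1/3)]` for `r = 0` and
`[(off+r+1, 1)]` otherwise (`blk = i/(L2−1)`, `r = i%(L2−1)`, `off = blk·L2`) — i.e. the `(i,j)` entry of `blkdiag(A,A)ᵀ M blkdiag(A,A)`. -/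
theorem projEntry_eq (Mf : ℕ → ℕ → ℚ) (L2 i j : ℕ) :
    projEntry Mf L2 i j = ((projCol L2 i).map fun rc => ((projCol L2 j).map fun sd => rc.2 * sd.2 * Mf rc.1 sd.1).sum).sum := rfl

/-- The pieces are `projTab` of the explicit entry functions (definitional restatements for the bridge). -/
theorem q0Piece_eq (N P : ℕ) (A C : ℚ) : q0Piece N P A C = projTab (twoDiag (N + P + 4) (q1Tab N P A C)) (N + P + 4) := rfl

/-- See `q0Piece_eq`. -/
theorem qphiPiece_eq (N P : ℕ) (D : ℚ) (p : ℕ) : qphiPiece N P D p = projTab (twoOff (N + P + 4) D (eTab N P p)) (N + P + 4) := rfl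

/-- See `q0Piece_eq`. -/
theorem qtPiece_eq (N P : ℕ) (D : ℚ) : qtPiece N P D = projTab (twoDiag (N + P + 4) (matScale (-1) (rTab N P D))) (N + P + 4) := rfl

end Summit.NavierStokesRegularity.TurbBounds.ShearSpecPieces
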